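import Literature.AnabelianGeometry.EtaleTheta.SettingModelKummerCocycleQ
import Literature.NumberTheory.EllipticCurves.TateCurve.TorsionGaloisModuleKummer
import HarnessLib

/-!
# The Tate-module dictionary for the affine character `σ ↦ (κ_q(σ), χ(σ))`: on the `N`-torsion of the
# Tate curve `E_q`, `q = p²`, every `σ ∈ G_{ℚ_p}` acts by the matrix `(χ_N(σ) κ_{q,N}(σ); 0 1)`
# (R78 cluster of the abc-iut cell, file F3d; STAGE 2 «Tate shear», arithmetic side)

J. Silverman, *Advanced Topics in the Arithmetic of Elliptic Curves* (1994) [SilvermanATAEC1994], V §3 and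
the proof of Prop. V.6.1 (PDF p. 411): for the Tate curve `E_q/K`, `E_q[N](K̄) = φ((ζ_N^ℤ · Q^ℤ)/q^ℤ)`,
`Q = q^{1/N}`, with `P₁ = φ(ζ_N)` fixed up to the cyclotomic character and `P₂^σ = P₂ + i·P₁` when
`Q^σ = ζ_N^i Q` [cite: SilvermanATAEC1994, proof of Prop. V.6.1 (PDF p. 411)]; S. Mochizuki, *The étale theta
function …*, Publ. RIMS **45** (2009) [EtTh], §1 p. 13: "`K_N := K(ζ_N, q_X^{1/N})`" — the field of
definition of the `N`-torsion [cite: MochizukiEtTh2009, §1 p.13].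

abc-iut cell, layer L2, seat abc-iut-L2-t5 (gen 5; Tate-curve / Kummer lineage).  PROOF-ONLY file
(0 definitions) joining F3c (`SettingModelKummerCocycleQ`: the CHOSEN roots `qRoots p`, the CHOSEN cyclotome
generator `cycGen p`, the Kummer cocycle `kappaQ p : G_{ℚ_p} → Ẑ` and F3's cyclotomic character `chi p`) to
the lineage's Tate-curve Galois module (`TateCurve/TorsionGaloisModuleKummer.lean`, p424935:
`exists_basis_kummer_galoisRepTorsion_tateCurve`, built on the kernel-checked Tate uniformisation
`uniformization_holds`).  This is the arithmetic side of abc-iut-L2-t6's F-t6g5-2 PAYOFF sentence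
"`(Δ^tp_X)^ell / N` becomes the `E_q[N]`-module verbatim (`σ·P₂ = P₂ + κ(σ) P₁`)":

* `exists_tateTorsionBasis_chi_kappaQ` — for every `N ≥ 1` there is a basis `P₁, P₂` of
  `E_{p²}[N](ℚ̄_p)` (generation + relations) with, for EVERY `σ ∈ G_{ℚ_p}`,
  **`σ • P₁ = χ_N(σ) • P₁`** and **`σ • P₂ = P₂ + κ_{q,N}(σ) • P₁`**, where
  `χ_N(σ) = (ZHatLevel.levelChar N (chi p σ)).val` and `κ_{q,N}(σ) = (toAdd (ZHatLevel.level N (kappaQ p σ))).val`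
  — the level-`N` shadow of `chiAff p σ = ⟨κ_q(σ), χ(σ)⟩` IS the matrix of `σ` on the Tate module;
* `levelChar_chi_eq_one_iff` — `χ_N(σ) = 1 ↔ σ` fixes the chosen `ξ_N`;
* `mem_ker_galoisRepTorsion_tateCurve_iff_chi_kappaQ` — **`σ` acts trivially on `E_{p²}[N](ℚ̄_p)` iff
  `χ_N(σ) = 1 ∧ κ_q(σ) ≡ 0 (N)`**, and `mem_ker_galoisRepTorsion_tateCurve_iff_mem_fixingSubgroup_fieldKN` —
  **iff `σ ∈ G_{K_N}`**, `K_N = ℚ_p(μ_N, q^{1/N}) = fieldKN ⊥ (qModel p) N`: "`K_N = ℚ_p(E_q[N])`" for the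
  model's `q`-parameter, kernel-checked.

`G_{ℚ_p}` appears as F3's `GQp p = (ℚ̄_p ≃ₐ[ℚ_p] ℚ̄_p)`; the Tate-curve files use Mathlib's (non-reducible)
`Field.absoluteGaloisGroup ℚ_[p]`, identified by the tree's `absoluteGaloisGroup.toAlgEquiv ℚ_[p]` (the
identity `MulEquiv`), so the statements below read `(toAlgEquiv ℚ_[p]).symm σ • P`.  Classical and
undisputed; a model is consistency evidence only; nothing here bears on [IUTchIII] Cor. 3.12.
-/

noncomputable section

open CategoryTheory ProfiniteGrp ProfiniteGrp.ProfiniteCompletion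

namespace Literature.AnabelianGeometry.EtaleTheta.SettingModel

open Literature.AnabelianGeometry.SemiGraphs (GQp)
open Literature.NumberTheory.EllipticCurves Literature.NumberTheory.EllipticCurves.TateCurve
open Literature.NumberTheory.EllipticCurves.SteinWuthrich2013 (tateCurve)
open WeierstrassCurve Field

variable (p : ℕ) [Fact p.Prime]

/-- `‖p²‖_p < 1`: the model's `q`-parameter lies in the maximal ideal of `ℤ_p`, so `E_{p²}` IS a Tate curve.
[cite: SilvermanATAEC1994, Thm. V.3.1 (PDF p. 395)] -/
theorem norm_natCast_sq_lt_one : ‖(((p : ℕ) : ℚ_[p]) ^ 2 : ℚ_[p])‖ < 1 := by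
  rw [norm_pow]
  exact pow_lt_one₀ (norm_nonneg _) Padic.norm_p_lt_one two_ne_zero

/-- `p² ≠ 0` in `ℚ_p`. [cite: SilvermanATAEC1994, Thm. V.3.1 (PDF p. 395)] -/
theorem natCast_sq_ne_zero : (((p : ℕ) : ℚ_[p]) ^ 2 : ℚ_[p]) ≠ 0 :=
  pow_ne_zero 2 (Nat.cast_ne_zero.mpr (Fact.out : p.Prime).ne_zero)

/-- The unit `q = p²` of `ℚ̄_p` (F3c's `qUnit p`) is the image of the unit `p² ∈ ℚ_pˣ`.
[cite: MochizukiEtTh2009, §1 p.13] -/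
theorem qUnit_eq_map_mk0 :
    qUnit p = Units.map (algebraMap ℚ_[p] (PadicAlgCl p) : ℚ_[p] →* PadicAlgCl p)
      (Units.mk0 _ (natCast_sq_ne_zero p)) :=
  Units.ext (by
    rw [coe_qUnit, Units.coe_map, MonoidHom.coe_coe, Units.val_mk0, map_pow, map_natCast]
    rfl)

/-- The chosen root `q^{1/N}` raised to `N` is the image of `p² ∈ ℚ_pˣ` (the hypothesis shape `hQ` of the
lineage's `exists_basis_kummer_galoisRepTorsion_tateCurve`). [cite: MochizukiEtTh2009, §1 p.13] -/
theorem qRoots_root_pow_eq_map (N : ℕ+) :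
    (qRoots p).root N ^ ((N : ℕ) : ℕ) =
      Units.map (algebraMap ℚ_[p] (AlgebraicClosure ℚ_[p]) : ℚ_[p] →* AlgebraicClosure ℚ_[p])
        (Units.mk0 _ (natCast_sq_ne_zero p)) := by
  rw [(qRoots p).pow_self, qUnit_eq_map_mk0]

/-- `σ • ξ_N = ξ_N ^ χ_N(σ)` on the chosen generator, as units (F3's `apply_cyclotome_eq_pow`).
[cite: MochizukiEtTh2009, §1 p.13] -/
theorem smul_cycGen_apply_eq_pow (σ : GQp p) (N : ℕ+) :
    σ • (cycGen p : ℕ+ → (PadicAlgCl p)ˣ) N =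
      (cycGen p : ℕ+ → (PadicAlgCl p)ˣ) N ^ (ZHatLevel.levelChar N (chi p σ)).val :=
  Units.ext (by
    rw [AlgEquiv.smul_units_def, Units.coe_map, MonoidHom.coe_coe, Units.val_pow_eq_pow_val]
    exact apply_cyclotome_eq_pow p σ (cycGen p) N)

/-- `σ • q^{1/N} / q^{1/N} = ξ_N ^ κ_{q,N}(σ)` on units: the Kummer cocycle of the chosen root read in the chosen
generator (F3c's `cycGen_pow_level` at `kappaCyc`). [cite: NeukirchANT1999, Ch. IV §3] -/
theorem smul_qRoots_root_div_eq_pow (σ : GQp p) (N : ℕ+) :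
    σ • (qRoots p).root N / (qRoots p).root N =
      (cycGen p : ℕ+ → (PadicAlgCl p)ˣ) N ^ (Multiplicative.toAdd (ZHatLevel.level N (kappaQ p σ))).val := by
  rw [← kappaCyc_apply, kappaQ_def]
  exact (cycGen_pow_level p (kappaCyc p σ) N).symm

/-- **The Tate-module dictionary.**  For every `N ≥ 1` there is a basis `P₁, P₂` of the `N`-torsion
`E_{p²}[N](ℚ̄_p)` of the Tate curve with parameter `q = p²` — every `N`-torsion point is `a•P₁ + b•P₂`, with
relations exactly `N ∣ a ∧ N ∣ b` — on which EVERY `σ ∈ G_{ℚ_p}` acts by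
`σ • P₁ = χ_N(σ) • P₁` and `σ • P₂ = P₂ + κ_{q,N}(σ) • P₁`:
the level-`N` shadow of the affine character `chiAff p σ = ⟨κ_q(σ), χ(σ)⟩` is the matrix
`(χ_N(σ) κ_{q,N}(σ); 0 1)` of `σ` in the basis `(P₁, P₂)` (`P₁ = φ(ξ_N)`, `P₂ = φ(q^{1/N})` for the CHOSEN
`ξ_N = cycGen p N`, `q^{1/N} = qRoot p N` and the Tate uniformisation `φ`).
[cite: SilvermanATAEC1994, proof of Prop. V.6.1 (PDF p. 411)] -/
theorem exists_tateTorsionBasis_chi_kappaQ (N : ℕ+) :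
    ∃ P₁ P₂ : geomPoints (tateCurve ((((p : ℕ) : ℚ_[p]) ^ 2 : ℚ_[p]))),
      ((N : ℕ) : ℤ) • P₁ = 0 ∧ ((N : ℕ) : ℤ) • P₂ = 0 ∧
      (∀ P : geomPoints (tateCurve ((((p : ℕ) : ℚ_[p]) ^ 2 : ℚ_[p]))), ((N : ℕ) : ℤ) • P = 0 →
        ∃ a b : ℤ, P = a • P₁ + b • P₂) ∧
      (∀ a b : ℤ, a • P₁ + b • P₂ = 0 ↔ ((N : ℕ) : ℤ) ∣ a ∧ ((N : ℕ) : ℤ) ∣ b) ∧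
      ∀ σ : GQp p,
        (absoluteGaloisGroup.toAlgEquiv ℚ_[p]).symm σ • P₁ = (ZHatLevel.levelChar N (chi p σ)).val • P₁ ∧
        (absoluteGaloisGroup.toAlgEquiv ℚ_[p]).symm σ • P₂ =
          P₂ + (Multiplicative.toAdd (ZHatLevel.level N (kappaQ p σ))).val • P₁ := by
  obtain ⟨P₁, P₂, h1, h2, hgen, hrel, hchi, hkum⟩ :=
    exists_basis_kummer_galoisRepTorsion_tateCurve (K := ℚ_[p]) (Units.mk0 _ (natCast_sq_ne_zero p))
      (norm_natCast_sq_lt_one p) N.pos (isPrimitiveRoot_coe_cycGen p N) (qRoots_root_pow_eq_map p N)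
  refine ⟨P₁, P₂, h1, h2, hgen, hrel, fun σ => ⟨?_, ?_⟩⟩
  · refine hchi _ _ ?_
    rw [MulEquiv.apply_symm_apply]
    exact smul_cycGen_apply_eq_pow p σ N
  · have h := hkum ((absoluteGaloisGroup.toAlgEquiv ℚ_[p]).symm σ)
      (Multiplicative.toAdd (ZHatLevel.level N (kappaQ p σ))).val
      (by rw [MulEquiv.apply_symm_apply]; exact smul_qRoots_root_div_eq_pow p σ N)
    rwa [sub_eq_iff_eq_add'] at h

/-- `χ_N(σ) = 1` iff `σ` fixes the chosen primitive `N`-th root of unity `ξ_N`.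
[cite: MochizukiEtTh2009, §1 p.13] -/
theorem levelChar_chi_eq_one_iff (σ : GQp p) (N : ℕ+) :
    ZHatLevel.levelChar N (chi p σ) = 1 ↔
      σ (((cycGen p : ℕ+ → (PadicAlgCl p)ˣ) N : (PadicAlgCl p)ˣ) : PadicAlgCl p) =
        (((cycGen p : ℕ+ → (PadicAlgCl p)ˣ) N : (PadicAlgCl p)ˣ) : PadicAlgCl p) := by
  have hξ := isPrimitiveRoot_coe_cycGen p N
  constructor
  · intro h
    rw [apply_eq_pow_levelChar_chi p σ N hξ.pow_eq_one, h, ZMod.val_one_eq_one_mod,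
      ← pow_eq_pow_mod 1 hξ.pow_eq_one, pow_one]
  · intro h
    rw [levelChar_chi_eq_of_isPrimitiveRoot p σ N hξ (c := 1) (by rw [pow_one]; exact h), Nat.cast_one]

/-- **`σ` acts trivially on `E_{p²}[N](ℚ̄_p)` iff `χ_N(σ) = 1 ∧ κ_q(σ) ≡ 0 (mod N)`** — the kernel of the mod-`N`
Galois representation of the Tate curve is the level-`N` kernel of the affine character (the lineage's
`mem_ker_galoisRepTorsion_tateCurve_iff_of_roots` at the chosen `ξ_N`, `q^{1/N}`).
[cite: SilvermanATAEC1994, Thm. V.3.1 (c),(d) (PDF pp. 395–399)] -/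
theorem mem_ker_galoisRepTorsion_tateCurve_iff_chi_kappaQ (N : ℕ+) (σ : GQp p) :
    (absoluteGaloisGroup.toAlgEquiv ℚ_[p]).symm σ ∈
        (galoisRepTorsion (tateCurve ((((p : ℕ) : ℚ_[p]) ^ 2 : ℚ_[p]))) ((N : ℕ) : ℤ)).ker ↔
      ZHatLevel.levelChar N (chi p σ) = 1 ∧ ZHatLevel.level N (kappaQ p σ) = 1 := by
  have hQ : qRoot p N ^ (N : ℕ) = algebraMap ℚ_[p] (AlgebraicClosure ℚ_[p]) ((((p : ℕ) : ℚ_[p]) ^ 2 : ℚ_[p])) := by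
    rw [qRoot_pow, map_pow, map_natCast]
    rfl
  rw [mem_ker_galoisRepTorsion_tateCurve_iff_of_roots _ (natCast_sq_ne_zero p) (norm_natCast_sq_lt_one p)
    N.pos (isPrimitiveRoot_coe_cycGen p N) hQ, levelChar_chi_eq_one_iff, level_kappaQ_eq_one_iff,
    absoluteGaloisGroup.smul_def, absoluteGaloisGroup.smul_def, MulEquiv.apply_symm_apply]

/-- **`Ker(G_{ℚ_p} → Aut E_{p²}[N](ℚ̄_p)) = G_{K_N}`** for `K_N = ℚ_p(μ_N, q^{1/N}) = fieldKN ⊥ (qModel p) N`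
("`K_N = ℚ_p(E_q[N])`" for the model's `q`-parameter), combining the previous theorem with F3c's
`mem_fixingSubgroup_fieldKN_iff`. [cite: MochizukiEtTh2009, §1 p.13] -/
theorem mem_ker_galoisRepTorsion_tateCurve_iff_mem_fixingSubgroup_fieldKN (N : ℕ+) (σ : GQp p) :
    (absoluteGaloisGroup.toAlgEquiv ℚ_[p]).symm σ ∈
        (galoisRepTorsion (tateCurve ((((p : ℕ) : ℚ_[p]) ^ 2 : ℚ_[p]))) ((N : ℕ) : ℤ)).ker ↔
      σ ∈ (fieldKN ⊥ (qModel p) N).fixingSubgroup := by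
  rw [mem_ker_galoisRepTorsion_tateCurve_iff_chi_kappaQ, mem_fixingSubgroup_fieldKN_iff]

end Literature.AnabelianGeometry.EtaleTheta.SettingModel

end
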